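import Summits.HubbardSuperconductivity.HubbardSuperconductivity.Theorems.AnisotropyChordTransferFibre3PlaneWave

/-!
# Route `AnisotropyChord` / H0 rotor rung: PORT N30-A proofs, part 4 — character sums and plane-wave orthogonality / completeness

Second step of the Krein reduction (memo ROTOR-THEORY-20 §277(a)): the fibre characters `phase K r` are the standard additive
characters of `ZMod L` composed with the dot product, so
* `sum_phase_right` : `Σ_r phase q r = [q = 0]·L²`, `sum_phase_left` : `Σ_k phase k r = [r = 0]·L²`;
* `ip_pw_pw` : `⟨pw_k, pw_k'⟩ = [k = k']·L⁴` (orthogonality), `sum_pw_conj_pw` : `Σ_k pw_k(c)·conj pw_k(c') = [c = c']·L⁴`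
  (completeness) — the Fourier analysis behind the pole-removed resolvent `Gentry`.
Prover seat `hubbard-h0-rotor-p1` g21 (theory seat `hubbard-h0-rotor-theory-1`, cycle 20, PORT SPEC N30-A); helper for
stmt-HubbardSuperconductivity-19089 (`--supports`).
-/

set_option linter.dupNamespace false
set_option autoImplicit false

noncomputable section

open scoped BigOperators
open Complex

namespace Summit.HubbardSuperconductivity.HubbardSuperconductivity.Theorems.AnisotropyChord.Transfer.Fibre3

variable (L : ℕ) [NeZero L]

/-! ## Character sums -/

/-- `phZ` is the standard additive character of `ZMod L`. [folklore] -/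
theorem phZ_eq_stdAddChar (x : ZMod L) : phZ L x = ZMod.stdAddChar x := by
  rw [ZMod.stdAddChar_apply, ZMod.toCircle_apply]
  unfold phZ
  congr 1
  ring

/-- `Σ_x e(b·x) = [b = 0]·L`. [folklore] -/
theorem sum_phZ_mul (b : ZMod L) : ∑ x : ZMod L, phZ L (x * b) = if b = 0 then (L : ℂ) else 0 := by
  classical
  simp_rw [phZ_eq_stdAddChar]
  rw [AddChar.sum_mulShift b (ZMod.isPrimitive_stdAddChar L), ZMod.card]
  split_ifs <;> simp

/-- the character is symmetric in momentum and position. [folklore] -/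
theorem phase_comm (k r : Tor L) : phase L k r = phase L r k := by
  rw [phase_eq_phZ, phase_eq_phZ]
  congr 1; unfold dotZ; ring

/-- `phase q r = e(q₁r₁)·e(q₂r₂)`. [folklore] -/
theorem phase_eq_mul (q r : Tor L) : phase L q r = phZ L (r.1 * q.1) * phZ L (r.2 * q.2) := by
  rw [phase_eq_phZ, ← phZ_add]
  congr 1; unfold dotZ; ring

/-- **`Σ_r phase q r = [q = 0]·L²`.** [folklore] -/
theorem sum_phase_right (q : Tor L) : ∑ r : Tor L, phase L q r = if q = 0 then ((L : ℂ) ^ 2) else 0 := by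
  classical
  simp_rw [phase_eq_mul]
  rw [Fintype.sum_prod_type]
  simp_rw [← Finset.mul_sum, ← Finset.sum_mul]
  rw [sum_phZ_mul, sum_phZ_mul]
  by_cases h1 : q.1 = 0
  · by_cases h2 : q.2 = 0
    · have hq : q = 0 := Prod.ext h1 h2
      simp [hq]; ring
    · have hq : q ≠ 0 := fun h => h2 (by rw [h]; rfl)
      simp [h1, h2, hq]
  · have hq : q ≠ 0 := fun h => h1 (by rw [h]; rfl)
    simp [h1, hq]

/-- **`Σ_k phase k r = [r = 0]·L²`.** [folklore] -/
theorem sum_phase_left (r : Tor L) : ∑ k : Tor L, phase L k r = if r = 0 then ((L : ℂ) ^ 2) else 0 := by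
  simp_rw [phase_comm L _ r]
  exact sum_phase_right L r

/-! ## Plane waves: orthogonality and completeness -/

/-- `conj(pw_k c)·pw_k' c = phase (k'₂ − k₂) a · phase (k'₃ − k₃) b`. [folklore] -/
theorem conj_pw_mul_pw (k k' : Tor L × Tor L) (c : Cfg L) :
    (starRingEnd ℂ) (pw L k.1 k.2 c) * pw L k'.1 k'.2 c = phase L (k'.1 - k.1) c.1 * phase L (k'.2 - k.2) c.2 := by
  unfold pw
  rw [map_mul, conj_phase, conj_phase, ← phase_neg_left, ← phase_neg_left, sub_eq_add_neg, sub_eq_add_neg,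
    phase_add_left, phase_add_left]
  ring

/-- **Orthogonality:** `⟨pw_k, pw_k'⟩ = [k = k']·L⁴`. [folklore] -/
theorem ip_pw_pw (k k' : Tor L × Tor L) :
    ip L (pw L k.1 k.2) (pw L k'.1 k'.2) = if k = k' then ((L : ℂ) ^ 2) ^ 2 else 0 := by
  classical
  unfold ip
  simp_rw [conj_pw_mul_pw]
  rw [Fintype.sum_prod_type]
  simp_rw [← Finset.mul_sum, ← Finset.sum_mul]
  rw [sum_phase_right, sum_phase_right]
  by_cases h1 : k'.1 - k.1 = 0
  · by_cases h2 : k'.2 - k.2 = 0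
    · have hk : k = k' := Prod.ext (sub_eq_zero.mp h1).symm (sub_eq_zero.mp h2).symm
      simp [hk]; ring
    · have hk : k ≠ k' := fun h => h2 (by rw [h, sub_self])
      simp [h1, h2, hk]
  · have hk : k ≠ k' := fun h => h1 (by rw [h, sub_self])
    simp [h1, hk]

/-- `pw_k(c)·conj pw_k(c') = phase k₂ (a − a')·phase k₃ (b − b')`. [folklore] -/
theorem pw_mul_conj_pw (k : Tor L × Tor L) (c c' : Cfg L) :
    pw L k.1 k.2 c * (starRingEnd ℂ) (pw L k.1 k.2 c') = phase L k.1 (c.1 - c'.1) * phase L k.2 (c.2 - c'.2) := by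
  unfold pw
  rw [map_mul, conj_phase, conj_phase, sub_eq_add_neg, sub_eq_add_neg, phase_add, phase_add]
  ring

/-- **Completeness:** `Σ_k pw_k(c)·conj pw_k(c') = [c = c']·L⁴`. [folklore] -/
theorem sum_pw_mul_conj_pw (c c' : Cfg L) :
    ∑ k : Tor L × Tor L, pw L k.1 k.2 c * (starRingEnd ℂ) (pw L k.1 k.2 c')
      = if c = c' then ((L : ℂ) ^ 2) ^ 2 else 0 := by
  classical
  simp_rw [pw_mul_conj_pw]
  rw [Fintype.sum_prod_type]
  simp_rw [← Finset.mul_sum, ← Finset.sum_mul]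
  rw [sum_phase_left, sum_phase_left]
  by_cases h1 : c.1 - c'.1 = 0
  · by_cases h2 : c.2 - c'.2 = 0
    · have hc : c = c' := Prod.ext (sub_eq_zero.mp h1) (sub_eq_zero.mp h2)
      simp [hc]; ring
    · have hc : c ≠ c' := fun h => h2 (by rw [h, sub_self])
      simp [h1, h2, hc]
  · have hc : c ≠ c' := fun h => h1 (by rw [h, sub_self])
    simp [h1, hc]

end Summit.HubbardSuperconductivity.HubbardSuperconductivity.Theorems.AnisotropyChord.Transfer.Fibre3

end
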